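import Literature.Barriers.ResolutionOfSingularities.LocalMonomializationFailsLemmaUnits
import Literature.Barriers.ResolutionOfSingularities.LocalMonomializationFailsLemmaBlock
import Literature.Barriers.ResolutionOfSingularities.LocalMonomializationFailsLemmaSeries
import HarnessLib

/-!
# Cutkosky's Lemma 3.1, conclusion (C4): `A → B_i` is not monomial for `0 ≤ i < p`

`Literature/Barriers/ResolutionOfSingularities/LocalMonomializationFailsLemmaNotMonomial.lean` —
the last conclusion of `Literature.Barriers.ResolutionOfSingularities.Cutkosky.CutkoskyLemma31`
(Cutkosky, Math. Ann. 362 (2015), Lemma 3.1: "Further, `A → B_i` is not monomial for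
`0 ≤ i < p`"). The printed proof computes, via Weierstrass preparation in `Â = k[[u,v]]`, the
leading forms in `B̂_i = k[[x_i,y_i]]` of the elements `u' = ε(u − φ(v))` of `A`; here the leading
forms (and, for `i = p − 1`, the `y_i`-adic orders) of ALL nonzero elements `h(u,v)/g(u,v)` of
`𝔪_A` are computed at once in the sheared presentation `ũ = u − (c₀/e₀ᵖ)vᵖ`, `v` (in which no
cancellation of leading forms occurs), and compared with the shape `δ · L(x')ᵃ L(y')ᵇ` forced by a
monomial form `u' = δ x'ᵃ y'ᵇ` (Def. 1.1):

* `0 ≤ i ≤ p − 2`: `x_i` divides the leading form of every element of `𝔪_A`, which forces one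
  regular parameter of `B_i` with nonzero `x_i`-coefficient to divide `u` and `v` — excluded by
  the divisor lemma `false_of_dvd_Tu_of_dvd_Tv` (printed: "`x_i ∣ L(u')`, a contradiction");
* `i = p − 1`: the leading form of an element of `𝔪_A` of order `p²j + pk` is divisible exactly by
  `ȳ^{p²j+(p−1)k}` while the element itself is not divisible by `ȳ^{(p²−p+1)j+(p−1)k+1}` (this
  uses `f₀ ≠ 0`, as the printed "`ȳ^{p²}` divides `u − φ(v)` … impossible since `f₀ ≠ 0`");
  for the two monomial generators this forces proportional exponent rows, i.e. `det = 0`.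

[cite: Cutkosky2014, Lemma 3.1 (proof, pp. 327–328)]
-/

noncomputable section

namespace Literature.Barriers.ResolutionOfSingularities

namespace Cutkosky

open Literature.AlgebraicGeometry.Resolution Literature.RingTheory.TwoVariableSeries IsLocalRing
open _root_.MvPowerSeries

universe u

variable {F : Type u} [Field F] {L : Type u} [Field L] [Algebra F L]

/-! ## Leading forms of the sheared pair (pure power-series computations) -/

section Shapes

/-- The degree-one component of a two-variable series is `coeff_X · X + coeff_Y · Y`. [folklore] -/
theorem homogeneousComponent_one_eq (f : MvPowerSeries (Fin 2) F) :
    homogeneousComponent 1 f = C (coeff (Finsupp.single 0 1) f) * X 0 + C (coeff (Finsupp.single 1 1) f) * X 1 := by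
  ext m
  rw [coeff_homogeneousComponent, map_add]
  by_cases hm : Finsupp.degree m = 1
  · rw [if_pos hm]
    rcases eq_single_of_degree_eq_one hm with rfl | rfl
    · rw [mul_comm (C _) (X 0), mul_comm (C _) (X 1), coeff_single_one_X_mul, constantCoeff_C,
        show (X 1 : MvPowerSeries (Fin 2) F) = X (0 : Fin 2).rev from rfl, coeff_single_one_X_rev_mul, add_zero]
    · rw [mul_comm (C _) (X 0), mul_comm (C _) (X 1), coeff_single_one_X_mul, constantCoeff_C,
        show (X 0 : MvPowerSeries (Fin 2) F) = X (1 : Fin 2).rev from rfl, coeff_single_one_X_rev_mul, zero_add]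
  · rw [if_neg hm]
    symm
    have h : IsHomogeneous (C (coeff (Finsupp.single 0 1) f) * X 0 + C (coeff (Finsupp.single 1 1) f) * X 1 :
        MvPowerSeries (Fin 2) F) (0 + 1) :=
      IsHomogeneous.add (IsHomogeneous.mul (isHomogeneous_C _) (isHomogeneous_X 0))
        (IsHomogeneous.mul (isHomogeneous_C _) (isHomogeneous_X 1))
    have := IsHomogeneous.coeff_eq_zero h (d := m) (by rwa [zero_add])
    rwa [map_add] at this

/-- `Xᵃ Yᵇ` has order `a + b` (as an inequality usable with `homogeneousComponent_mul_of_le_order`).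
[folklore] -/
theorem le_order_X_pow_mul_X_pow (a b : ℕ) :
    ((a + b : ℕ) : ℕ∞) ≤ ((X 0 : MvPowerSeries (Fin 2) F) ^ a * X 1 ^ b).order :=
  (leadingForm_X_pow_mul_X_pow (F := F) a b).1.symm.le

/-- The homogeneous component of `Xᵃ Yᵇ` in its own degree is itself. [folklore] -/
theorem homogeneousComponent_X_pow_mul_X_pow (a b : ℕ) :
    homogeneousComponent (a + b) ((X 0 : MvPowerSeries (Fin 2) F) ^ a * X 1 ^ b) = X 0 ^ a * X 1 ^ b :=
  ((isHomogeneous_iff_eq_homogeneousComponent).mp (isHomogeneous_X_pow_mul_X_pow a b)).symm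

/-- **`L(q₁)` for `i ≤ p − 2`**: `q₁ = Yⁱ (X E₂ + Yʳ E₃)` with `r ≥ 2`, `E₂(0) = e₀ ≠ 0` has order
`i + 1` and leading form `e₀ X Yⁱ`. [cite: Cutkosky2014, Lemma 3.1 (proof, `L(v) = e₀ x_i y_iⁱ`)] -/
theorem order_and_leadingForm_q1_X (i r : ℕ) (hr : 2 ≤ r) {E₂ E₃ : MvPowerSeries (Fin 2) F} {e₀ : F}
    (hE₂ : constantCoeff E₂ = e₀) (he : e₀ ≠ 0) :
    ((X 1 : MvPowerSeries (Fin 2) F) ^ i * (X 0 * E₂ + X 1 ^ r * E₃)).order = ((i + 1 : ℕ) : ℕ∞) ∧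
      leadingForm ((X 1 : MvPowerSeries (Fin 2) F) ^ i * (X 0 * E₂ + X 1 ^ r * E₃)) =
        X 0 ^ 1 * X 1 ^ i * C e₀ := by
  set w := (X 0 : MvPowerSeries (Fin 2) F) * E₂ + X 1 ^ r * E₃ with hw
  have hw0 : constantCoeff w = 0 := by
    rw [hw, map_add, map_mul, map_mul, constantCoeff_X, zero_mul, zero_add, map_pow, constantCoeff_X,
      zero_pow (by omega), zero_mul]
  have hw1 : homogeneousComponent 1 w = C e₀ * X 0 := by
    rw [hw, map_add, homogeneousComponent_one_X_mul, hE₂, homogeneousComponent_one_X_pow_mul hr, add_zero]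
  have hYi : ((i : ℕ) : ℕ∞) ≤ ((X 1 : MvPowerSeries (Fin 2) F) ^ i).order := by
    have := le_order_X_pow_mul_X_pow (F := F) 0 i
    rwa [pow_zero, one_mul, zero_add] at this
  have hcomp : homogeneousComponent (i + 1) ((X 1 : MvPowerSeries (Fin 2) F) ^ i * w) = X 0 ^ 1 * X 1 ^ i * C e₀ := by
    rw [homogeneousComponent_mul_of_le_order hYi (one_le_order_iff_constCoeff_eq_zero.mpr hw0), hw1]
    have : homogeneousComponent i ((X 1 : MvPowerSeries (Fin 2) F) ^ i) = X 1 ^ i := by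
      have := homogeneousComponent_X_pow_mul_X_pow (F := F) 0 i
      rwa [pow_zero, one_mul, zero_add] at this
    rw [this, pow_one]
    ring
  have hne : homogeneousComponent (i + 1) ((X 1 : MvPowerSeries (Fin 2) F) ^ i * w) ≠ 0 := by
    rw [hcomp, pow_one]
    refine mul_ne_zero (mul_ne_zero (X_ne_zero' 0) (pow_ne_zero _ (X_ne_zero' 1))) ?_
    rwa [Ne, map_eq_zero_iff _ (C_injective (σ := Fin 2) (R := F))]
  have hlt : ∀ d : Fin 2 →₀ ℕ, Finsupp.degree d < i + 1 → coeff d ((X 1 : MvPowerSeries (Fin 2) F) ^ i * w) = 0 := by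
    intro d hd
    apply coeff_of_lt_order
    refine lt_of_lt_of_le ?_ le_order_mul
    refine lt_of_lt_of_le ?_ (add_le_add hYi (one_le_order_iff_constCoeff_eq_zero.mpr hw0))
    exact_mod_cast hd
  obtain ⟨hord, hL⟩ := order_eq_and_leadingForm_eq hne hlt
  exact ⟨hord, hL.trans hcomp⟩

/-- **`L(q₁)` for `i = p − 1`**: `q₁ = Yⁱ (X E₂ + Y E₃)` with `E₂(0) = e₀`, `E₃(0) = τ̄₀`, `e₀ ≠ 0`
has order `i + 1` and leading form `Yⁱ (e₀ X + τ̄₀ Y)`.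
[cite: Cutkosky2014, Lemma 3.1 (proof, `L(v) = ȳ^{p−1}(τ̄₀ȳ + e₀x̄)`)] -/
theorem order_and_leadingForm_q1_Y (i : ℕ) {E₂ E₃ : MvPowerSeries (Fin 2) F} {e₀ τb : F}
    (hE₂ : constantCoeff E₂ = e₀) (hE₃ : constantCoeff E₃ = τb) (he : e₀ ≠ 0) :
    ((X 1 : MvPowerSeries (Fin 2) F) ^ i * (X 0 * E₂ + X 1 ^ 1 * E₃)).order = ((i + 1 : ℕ) : ℕ∞) ∧
      leadingForm ((X 1 : MvPowerSeries (Fin 2) F) ^ i * (X 0 * E₂ + X 1 ^ 1 * E₃)) =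
        X 1 ^ i * (C e₀ * X 0 + C τb * X 1) := by
  set w := (X 0 : MvPowerSeries (Fin 2) F) * E₂ + X 1 ^ 1 * E₃ with hw
  have hw0 : constantCoeff w = 0 := by
    rw [hw, map_add, map_mul, map_mul, constantCoeff_X, zero_mul, zero_add, pow_one, constantCoeff_X, zero_mul]
  have hw1 : homogeneousComponent 1 w = C e₀ * X 0 + C τb * X 1 := by
    rw [hw, map_add, homogeneousComponent_one_X_mul, hE₂, pow_one, homogeneousComponent_one_X_mul, hE₃]
  have hYi : ((i : ℕ) : ℕ∞) ≤ ((X 1 : MvPowerSeries (Fin 2) F) ^ i).order := by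
    have := le_order_X_pow_mul_X_pow (F := F) 0 i
    rwa [pow_zero, one_mul, zero_add] at this
  have hcomp : homogeneousComponent (i + 1) ((X 1 : MvPowerSeries (Fin 2) F) ^ i * w) =
      X 1 ^ i * (C e₀ * X 0 + C τb * X 1) := by
    rw [homogeneousComponent_mul_of_le_order hYi (one_le_order_iff_constCoeff_eq_zero.mpr hw0), hw1]
    have : homogeneousComponent i ((X 1 : MvPowerSeries (Fin 2) F) ^ i) = X 1 ^ i := by
      have := homogeneousComponent_X_pow_mul_X_pow (F := F) 0 i
      rwa [pow_zero, one_mul, zero_add] at this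
    rw [this]
  have hne : homogeneousComponent (i + 1) ((X 1 : MvPowerSeries (Fin 2) F) ^ i * w) ≠ 0 := by
    rw [hcomp]
    refine mul_ne_zero (pow_ne_zero _ (X_ne_zero' 1)) fun h0 => ?_
    have h := congrArg (coeff (Finsupp.single 0 1)) h0
    rw [map_add, map_zero, mul_comm (C e₀), mul_comm (C τb), coeff_single_one_X_mul, constantCoeff_C,
      show (X 1 : MvPowerSeries (Fin 2) F) = X (0 : Fin 2).rev from rfl, coeff_single_one_X_rev_mul,
      add_zero] at h
    exact he h
  have hlt : ∀ d : Fin 2 →₀ ℕ, Finsupp.degree d < i + 1 → coeff d ((X 1 : MvPowerSeries (Fin 2) F) ^ i * w) = 0 := by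
    intro d hd
    apply coeff_of_lt_order
    refine lt_of_lt_of_le ?_ le_order_mul
    refine lt_of_lt_of_le ?_ (add_le_add hYi (one_le_order_iff_constCoeff_eq_zero.mpr hw0))
    exact_mod_cast hd
  obtain ⟨hord, hL⟩ := order_eq_and_leadingForm_eq hne hlt
  exact ⟨hord, hL.trans hcomp⟩

/-- **`L(q₀)` for `i ≤ p − 2`**: `q₀ = Yᵐ (Xᵖ V − C c · Yˢ G)` with `V(0) = 0`, `V₁ ≠ 0` the
degree-one component of `V`, and `s ≥ p + 2`, has order `m + p + 1` and leading form
`Xᵖ Yᵐ V₁`. [cite: Cutkosky2014, Lemma 3.1 (proof, `u − φ(v) = f₀x_iᵖy_i^{pi+1} + …`)] -/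
theorem order_and_leadingForm_q0_X (m p s : ℕ) (hs : p + 2 ≤ s) {V G : MvPowerSeries (Fin 2) F} (c : F)
    (hV0 : constantCoeff V = 0) (hV1 : homogeneousComponent 1 V ≠ 0) :
    ((X 1 : MvPowerSeries (Fin 2) F) ^ m * (X 0 ^ p * V - C c * X 1 ^ s * G)).order = ((m + p + 1 : ℕ) : ℕ∞) ∧
      leadingForm ((X 1 : MvPowerSeries (Fin 2) F) ^ m * (X 0 ^ p * V - C c * X 1 ^ s * G)) =
        X 0 ^ p * X 1 ^ m * homogeneousComponent 1 V := by
  set f := (X 1 : MvPowerSeries (Fin 2) F) ^ m * (X 0 ^ p * V - C c * X 1 ^ s * G) with hf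
  have hsplit : f = X 0 ^ p * X 1 ^ m * V - X 0 ^ 0 * X 1 ^ (m + s) * (C c * G) := by
    rw [hf, pow_zero, one_mul, pow_add]; ring
  -- orders of the two terms
  have h1 : ((m + p + 1 : ℕ) : ℕ∞) ≤ ((X 0 : MvPowerSeries (Fin 2) F) ^ p * X 1 ^ m * V).order := by
    refine le_trans ?_ le_order_mul
    refine le_trans ?_ (add_le_add (le_order_X_pow_mul_X_pow p m) (one_le_order_iff_constCoeff_eq_zero.mpr hV0))
    push_cast
    exact le_of_eq (by ring)
  have h2 : ((m + p + 2 : ℕ) : ℕ∞) ≤ ((X 0 : MvPowerSeries (Fin 2) F) ^ 0 * X 1 ^ (m + s) * (C c * G)).order := by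
    refine le_trans ?_ le_order_mul
    refine le_trans ?_ (add_le_add (le_order_X_pow_mul_X_pow 0 (m + s)) zero_le)
    rw [add_zero]
    exact_mod_cast (by omega)
  have hcomp : homogeneousComponent (m + p + 1) f = X 0 ^ p * X 1 ^ m * homogeneousComponent 1 V := by
    rw [hsplit, map_sub]
    have e1 : homogeneousComponent (m + p + 1) ((X 0 : MvPowerSeries (Fin 2) F) ^ p * X 1 ^ m * V) =
        X 0 ^ p * X 1 ^ m * homogeneousComponent 1 V := by
      rw [show m + p + 1 = (p + m) + 1 by ring,
        homogeneousComponent_mul_of_le_order (le_order_X_pow_mul_X_pow p m) (one_le_order_iff_constCoeff_eq_zero.mpr hV0),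
        homogeneousComponent_X_pow_mul_X_pow]
    have e2 : homogeneousComponent (m + p + 1) ((X 0 : MvPowerSeries (Fin 2) F) ^ 0 * X 1 ^ (m + s) * (C c * G)) = 0 := by
      apply homogeneousComponent_of_lt_order_eq_zero
      refine lt_of_lt_of_le ?_ h2
      exact_mod_cast (by omega)
    rw [e1, e2, sub_zero]
  have hne : homogeneousComponent (m + p + 1) f ≠ 0 := by
    rw [hcomp]
    exact mul_ne_zero (mul_ne_zero (pow_ne_zero _ (X_ne_zero' 0)) (pow_ne_zero _ (X_ne_zero' 1))) hV1
  have hlt : ∀ d : Fin 2 →₀ ℕ, Finsupp.degree d < m + p + 1 → coeff d f = 0 := by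
    intro d hd
    rw [hsplit, map_sub]
    have hd' : ((Finsupp.degree d : ℕ) : ℕ∞) < ((m + p + 1 : ℕ) : ℕ∞) := by exact_mod_cast hd
    rw [coeff_of_lt_order (lt_of_lt_of_le hd' h1), coeff_of_lt_order (lt_of_lt_of_le hd' (le_trans (by exact_mod_cast (by omega)) h2)),
      sub_zero]
  obtain ⟨hord, hL⟩ := order_eq_and_leadingForm_eq hne hlt
  exact ⟨hord, hL.trans hcomp⟩

/-- **`L(q₀)` for `i = p − 1`**: `q₀ = Yᵐ (Xᵖ V − C c · Yᵖ G)` with `V(0) = 0`, `G(0) = τ̄₀`,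
`c τ̄₀ᵖ ≠ 0`, has order `m + p` and leading form `−c τ̄₀ᵖ · Y^{m+p}`.
[cite: Cutkosky2014, Lemma 3.1 (proof, `L(u − φ(v)) = −(c₀/e₀ᵖ) τ̄₀ ȳ^{p²}`)] -/
theorem order_and_leadingForm_q0_Y (m p : ℕ) {V G : MvPowerSeries (Fin 2) F} {c τb : F}
    (hV0 : constantCoeff V = 0) (hG : constantCoeff G = τb) (hcτ : c * τb ^ p ≠ 0) :
    ((X 1 : MvPowerSeries (Fin 2) F) ^ m * (X 0 ^ p * V - C c * X 1 ^ p * G ^ p)).order = ((m + p : ℕ) : ℕ∞) ∧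
      leadingForm ((X 1 : MvPowerSeries (Fin 2) F) ^ m * (X 0 ^ p * V - C c * X 1 ^ p * G ^ p)) =
        C (-(c * τb ^ p)) * X 1 ^ (m + p) := by
  set f := (X 1 : MvPowerSeries (Fin 2) F) ^ m * (X 0 ^ p * V - C c * X 1 ^ p * G ^ p) with hf
  have hsplit : f = X 0 ^ p * X 1 ^ m * V - X 0 ^ 0 * X 1 ^ (m + p) * (C c * G ^ p) := by
    rw [hf, pow_zero, one_mul, pow_add]; ring
  have h1 : ((m + p + 1 : ℕ) : ℕ∞) ≤ ((X 0 : MvPowerSeries (Fin 2) F) ^ p * X 1 ^ m * V).order := by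
    refine le_trans ?_ le_order_mul
    refine le_trans ?_ (add_le_add (le_order_X_pow_mul_X_pow p m) (one_le_order_iff_constCoeff_eq_zero.mpr hV0))
    push_cast
    exact le_of_eq (by ring)
  have h2 : ((m + p : ℕ) : ℕ∞) ≤ ((X 0 : MvPowerSeries (Fin 2) F) ^ 0 * X 1 ^ (m + p) * (C c * G ^ p)).order := by
    refine le_trans ?_ le_order_mul
    refine le_trans ?_ (add_le_add (le_order_X_pow_mul_X_pow 0 (m + p)) zero_le)
    rw [add_zero, zero_add]
  have hcomp : homogeneousComponent (m + p) f = C (-(c * τb ^ p)) * X 1 ^ (m + p) := by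
    rw [hsplit, map_sub]
    have e1 : homogeneousComponent (m + p) ((X 0 : MvPowerSeries (Fin 2) F) ^ p * X 1 ^ m * V) = 0 := by
      apply homogeneousComponent_of_lt_order_eq_zero
      refine lt_of_lt_of_le ?_ h1
      exact_mod_cast (by omega)
    have e2 : homogeneousComponent (m + p) ((X 0 : MvPowerSeries (Fin 2) F) ^ 0 * X 1 ^ (m + p) * (C c * G ^ p)) =
        X 1 ^ (m + p) * C (c * τb ^ p) := by
      have key : homogeneousComponent ((0 + (m + p)) + 0) ((X 0 : MvPowerSeries (Fin 2) F) ^ 0 * X 1 ^ (m + p) * (C c * G ^ p)) =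
          X 0 ^ 0 * X 1 ^ (m + p) * homogeneousComponent 0 (C c * G ^ p) := by
        rw [homogeneousComponent_mul_of_le_order (le_order_X_pow_mul_X_pow 0 (m + p)) zero_le,
          homogeneousComponent_X_pow_mul_X_pow]
      rw [add_zero, zero_add] at key
      rw [key, homogeneousComponent_zero', map_mul, map_pow, constantCoeff_C, hG, pow_zero, one_mul]
    rw [e1, e2, zero_sub, map_neg]
    ring
  have hne : homogeneousComponent (m + p) f ≠ 0 := by
    rw [hcomp]
    refine mul_ne_zero ?_ (pow_ne_zero _ (X_ne_zero' 1))
    rw [Ne, map_eq_zero_iff _ (C_injective (σ := Fin 2) (R := F)), neg_eq_zero]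
    exact hcτ
  have hlt : ∀ d : Fin 2 →₀ ℕ, Finsupp.degree d < m + p → coeff d f = 0 := by
    intro d hd
    rw [hsplit, map_sub]
    have hd' : ((Finsupp.degree d : ℕ) : ℕ∞) < ((m + p : ℕ) : ℕ∞) := by exact_mod_cast hd
    rw [coeff_of_lt_order (lt_of_lt_of_le hd' (le_trans (by exact_mod_cast (by omega)) h1)),
      coeff_of_lt_order (lt_of_lt_of_le hd' h2), sub_zero]
  obtain ⟨hord, hL⟩ := order_eq_and_leadingForm_eq hne hlt
  exact ⟨hord, hL.trans hcomp⟩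

end Shapes

/-! ## Elements of `𝔪_A` in the sheared presentation -/

section Elements

/-- The shear `U ↦ U + c Vⁿ`, `V ↦ V` (`n ≠ 0`) does not change constant terms. [folklore] -/
theorem constantCoeff_bind₁_shear (c : F) {n : ℕ} (hn : n ≠ 0) (f : MvPolynomial (Fin 2) F) :
    MvPolynomial.constantCoeff (MvPolynomial.bind₁
      ![(MvPolynomial.X 0 + MvPolynomial.C c * MvPolynomial.X 1 ^ n : MvPolynomial (Fin 2) F), MvPolynomial.X 1] f) =
      MvPolynomial.constantCoeff f := by
  induction f using MvPolynomial.induction_on with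
  | C a => simp
  | add f g hf hg => simp only [map_add, hf, hg]
  | mul_X f i hf =>
    fin_cases i <;> simp [hf, MvPolynomial.constantCoeff_X, hn]

variable {a : Fin 2 → L} (ha : AlgebraicIndependent F a) {b' : Fin 2 → L} (hB : AlgebraicIndependent F b')
  (hle : originLocalRing ha ≤ originLocalRing hB)

/-- **Nonzero elements of `𝔪_A` in the sheared presentation.** For `z ∈ 𝔪_A ∖ 0`,
`A = F[u,v]_{(u,v)} ⊆ B'` with `u, v ∈ 𝔪_{B'}`: `T z · G = h(T u − c (T v)ⁿ, T v)` in `B̂'` for a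
unit `G`, a nonzero polynomial `h` with `h(0) = 0` (namely `h(U, V) = f(U + cVⁿ, V)` where
`z = f(u,v)/g(u,v)`). [cite: Cutkosky2014, Lemma 3.1 (proof)] -/
theorem exists_rep_of_mem_maximalIdeal
    (hmax : ∀ j, haveI := isLocalRing_originLocalRing hB;
      (⟨a j, hle (mem_originLocalRing_self ha j)⟩ : originLocalRing hB) ∈ maximalIdeal (originLocalRing hB))
    (c : F) {n : ℕ} (hn : n ≠ 0) (z : originLocalRing ha)
    (hz : haveI := isLocalRing_originLocalRing ha; z ∈ maximalIdeal (originLocalRing ha)) (hz0 : z ≠ 0) :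
    ∃ (h : MvPolynomial (Fin 2) F) (G : MvPowerSeries (Fin 2) F), constantCoeff G ≠ 0 ∧ h ≠ 0 ∧
      MvPolynomial.constantCoeff h = 0 ∧
      originTaylorAt hB ⟨z, hle z.2⟩ * G =
        MvPolynomial.aeval ![originTaylorAt hB ⟨a 0, hle (mem_originLocalRing_self ha 0)⟩ -
            C c * originTaylorAt hB ⟨a 1, hle (mem_originLocalRing_self ha 1)⟩ ^ n,
          originTaylorAt hB ⟨a 1, hle (mem_originLocalRing_self ha 1)⟩] h := by
  haveI := isLocalRing_originLocalRing ha
  haveI := isLocalRing_originLocalRing hB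
  haveI := isDomain_mvPowerSeries (F := F) (Fin 2)
  obtain ⟨f, g, hg, hzfg⟩ := (mem_originLocalRing_iff ha).mp z.2
  have hf0 : MvPolynomial.constantCoeff f = 0 := by
    have hz' : (⟨MvPolynomial.aeval a f / MvPolynomial.aeval a g, hzfg ▸ z.2⟩ : originLocalRing ha) ∈
        maximalIdeal (originLocalRing ha) := by
      have e : (⟨MvPolynomial.aeval a f / MvPolynomial.aeval a g, hzfg ▸ z.2⟩ : originLocalRing ha) = z :=
        Subtype.ext hzfg.symm
      rw [e]; exact hz
    exact (div_mem_maximalIdeal_originLocalRing_iff ha f g hg _).mp hz'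
  have hmul := originTaylorAt_inclusion_mul ha hB hle z.2 f g hg hzfg
  set Ta : Fin 2 → MvPowerSeries (Fin 2) F := fun i => originTaylorAt hB ⟨a i, coord_mem_of_le ha hB hle i⟩ with hTa
  have hG : IsUnit (MvPolynomial.aeval Ta g) := isUnit_aeval_originTaylorAt_coord ha hB hle hmax hg
  set σ : Fin 2 → MvPolynomial (Fin 2) F := ![MvPolynomial.X 0 + MvPolynomial.C c * MvPolynomial.X 1 ^ n,
    MvPolynomial.X 1] with hσ
  set q : Fin 2 → MvPowerSeries (Fin 2) F := ![Ta 0 - C c * Ta 1 ^ n, Ta 1] with hq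
  have hqσ : (fun i => MvPolynomial.aeval q (σ i)) = Ta := by
    funext i
    fin_cases i
    · simp only [hσ, hq, Fin.zero_eta, Matrix.cons_val_zero, map_add, map_mul, map_pow, MvPolynomial.aeval_X,
        Matrix.cons_val_one, Matrix.cons_val_fin_one, MvPolynomial.aeval_C]
      change Ta 0 - C c * Ta 1 ^ n + C c * Ta 1 ^ n = Ta 0
      ring
    · simp [hσ, hq]
  refine ⟨MvPolynomial.bind₁ σ f, MvPolynomial.aeval Ta g, ?_, ?_, ?_, ?_⟩
  · exact (isUnit_iff_constantCoeff.mp hG).ne_zero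
  · intro h0
    have h1 : MvPolynomial.aeval q (MvPolynomial.bind₁ σ f) = 0 := by rw [h0, map_zero]
    rw [MvPolynomial.aeval_bind₁, hqσ, ← hmul] at h1
    rcases mul_eq_zero.mp h1 with h2 | h2
    · apply hz0
      have h3 : (⟨(z : L), hle z.2⟩ : originLocalRing hB) = 0 := originTaylorAt_injective hB (h2.trans (map_zero _).symm)
      exact Subtype.ext (show (z : L) = 0 from congrArg Subtype.val h3)
    · exact hG.ne_zero h2
  · exact (constantCoeff_bind₁_shear c hn f).trans hf0
  · rw [MvPolynomial.aeval_bind₁, hqσ]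
    exact hmul

variable (p : ℕ) [hp : Fact p.Prime] {b : Fin 2 → L} (hb : AlgebraicIndependent F b)
  (hAB : originLocalRing ha ≤ originLocalRing hb)

/-- **The expansions in `B̂_i` for `1 ≤ i < p`, with their restrictions to `y_i = 0`.** As
`expansions_in_Bi`, and in addition `U₁(x_i, 0) = c₀`, `E₂(x_i, 0) = e₀`: setting `y_i = 0` kills
both `x = x_i y_iⁱ` and `y = y_i`, hence restricts every element of `B` to its residue.
[cite: Cutkosky2014, Lemma 3.1 (proof, expansions of `u`, `v` in `B̂_i`)] -/
theorem expansions_in_Bi_fine {c₀ f₀ e₀ : F} {τ₀ : MvPowerSeries (Fin 2) F}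
    (hshape : LemmaShape p hb ⟨a 0, hAB (mem_originLocalRing_self ha 0)⟩
      ⟨a 1, hAB (mem_originLocalRing_self ha 1)⟩ c₀ f₀ e₀ τ₀)
    (α : F) {i : ℕ} (hi : i < p) (hi1 : 1 ≤ i) (hB : AlgebraicIndependent F (bCoord F L p (b 0) (b 1) α i)) :
    ∃ (hleB : originLocalRing hb ≤ originLocalRing hB) (U₁ E₂ E₃ : MvPowerSeries (Fin 2) F),
      constantCoeff U₁ = c₀ ∧ coeff (Finsupp.single 1 1) U₁ = f₀ ∧
      constantCoeff E₂ = e₀ ∧ constantCoeff E₃ = constantCoeff τ₀ ∧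
      killVar 1 U₁ = PowerSeries.C c₀ ∧ killVar 1 E₂ = PowerSeries.C e₀ ∧
      originTaylorAt hB ⟨a 0, hleB (hAB (mem_originLocalRing_self ha 0))⟩ =
        X 0 ^ p * X 1 ^ (p * i) * U₁ ∧
      originTaylorAt hB ⟨a 1, hleB (hAB (mem_originLocalRing_self ha 1))⟩ =
        X 1 ^ i * (X 0 * E₂ + X 1 ^ (p - i) * E₃) := by
  have hp0 : p ≠ 0 := hp.out.ne_zero
  obtain ⟨u₁, v₂, v₃, hu, hv, hu₁, hDu₁, hv₂, hv₃⟩ := exists_decomp_of_lemmaShape hb hp0 hshape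
  obtain ⟨hle', hmax, hTx, hTy⟩ := le_Bi p hb α hi hB
  have hκ : ∀ w : originLocalRing hb, killVar 1 (originTaylorAt hB (Subalgebra.inclusion hle' w)) =
      PowerSeries.C (constantCoeff (originTaylorAt hb w)) := by
    intro w
    have h := map_originTaylorAt_inclusion_eq_residue hb hB hle' (ψ := killVar 1) (fun j => ?_) w.2
    · exact h
    fin_cases j
    · change killVar 1 (originTaylorAt hB ⟨b 0, _⟩) = 0
      rw [hTx, map_mul, map_pow, killVar_X_self, zero_pow (by omega), mul_zero]
    · change killVar 1 (originTaylorAt hB ⟨b 1, _⟩) = 0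
      rw [hTy, killVar_X_self]
  refine ⟨hle', originTaylorAt hB (Subalgebra.inclusion hle' u₁), originTaylorAt hB (Subalgebra.inclusion hle' v₂),
    originTaylorAt hB (Subalgebra.inclusion hle' v₃), ?_, ?_, ?_, ?_, ?_, ?_, ?_, ?_⟩
  · rw [← hu₁]; exact constantCoeff_originTaylorAt_inclusion hb hB hle' hmax u₁.2
  · rw [← hDu₁]
    refine coeff_single_one_originTaylorAt_inclusion hb hB hle' 1 1 hmax (Fin.forall_fin_two.mpr ⟨?_, ?_⟩) u₁.2
    · rw [hTx, coeff_single_one_one_X_zero_mul, coeff_single_one_one_X_zero]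
    · rw [hTy]
  · rw [← hv₂]; exact constantCoeff_originTaylorAt_inclusion hb hB hle' hmax v₂.2
  · rw [← hv₃]; exact constantCoeff_originTaylorAt_inclusion hb hB hle' hmax v₃.2
  · rw [hκ, hu₁]
  · rw [hκ, hv₂]
  · have e : (⟨a 0, hle' (hAB (mem_originLocalRing_self ha 0))⟩ : originLocalRing hB) =
        Subalgebra.inclusion hle' ⟨a 0, hAB (mem_originLocalRing_self ha 0)⟩ := rfl
    have hxB : Subalgebra.inclusion hle' (originCoord hb 0) = ⟨b 0, hle' (mem_originLocalRing_self hb 0)⟩ := rfl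
    rw [e, hu, map_mul, map_pow, map_mul, map_pow, hxB, hTx, mul_pow, ← pow_mul, mul_comm i p]
  · have e : (⟨a 1, hle' (hAB (mem_originLocalRing_self ha 1))⟩ : originLocalRing hB) =
        Subalgebra.inclusion hle' ⟨a 1, hAB (mem_originLocalRing_self ha 1)⟩ := rfl
    have hxB : Subalgebra.inclusion hle' (originCoord hb 0) = ⟨b 0, hle' (mem_originLocalRing_self hb 0)⟩ := rfl
    have hyB : Subalgebra.inclusion hle' (originCoord hb 1) = ⟨b 1, hle' (mem_originLocalRing_self hb 1)⟩ := rfl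
    rw [e, hv]
    simp only [map_add, map_mul, map_pow]
    rw [hxB, hyB, hTx, hTy]
    have hsplit : (X 1 : MvPowerSeries (Fin 2) F) ^ p = X 1 ^ i * X 1 ^ (p - i) := by
      rw [← pow_add, Nat.add_sub_cancel' hi.le]
    rw [hsplit]
    ring

end Elements

/-! ## Monomial data in `B̂_i` and the two endgames -/

section Endgame

variable {b' : Fin 2 → L} (hB : AlgebraicIndependent F b') {a : Fin 2 → L} (ha : AlgebraicIndependent F a)
  (hle : originLocalRing ha ≤ originLocalRing hB)

/-- **Monomial data transported to `B̂_i = F[[X,Y]]`.** From a monomial form of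
`A = F[u,v]_{(u,v)} → B_i` (Def. 1.1) one gets: generators `x₀, x₁` of `𝔪_A`, the expansions
`Y₀, Y₁` of a regular system of parameters of `B_i` (vanishing at the origin, with the variables in
the ideal they generate), unit series `D₀, D₁` and the exponent matrix `a` with `det a ≠ 0` such
that `T xᵢ = Dᵢ · Y₀^{aᵢ₀} · Y₁^{aᵢ₁}`. [cite: Cutkosky2014, Def. 1.1 and Lemma 3.1 (proof)] -/
theorem exists_series_of_isMonomialExtension
    (hmono : @IsMonomialExtension (originLocalRing ha) (originLocalRing hB) _ _ (inclusionAlgebra hle)) :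
    ∃ (x : Fin 2 → originLocalRing ha) (Y D : Fin 2 → MvPowerSeries (Fin 2) F) (A : Matrix (Fin 2) (Fin 2) ℕ),
      (haveI := isLocalRing_originLocalRing ha; Ideal.span (Set.range x) = maximalIdeal (originLocalRing ha)) ∧
      (∀ j, constantCoeff (Y j) = 0) ∧
      (∀ k : Fin 2, ∃ r s : MvPowerSeries (Fin 2) F, (X k : MvPowerSeries (Fin 2) F) = r * Y 0 + s * Y 1) ∧
      (∀ i, constantCoeff (D i) ≠ 0) ∧
      (A.map (Nat.cast : ℕ → ℤ)).det ≠ 0 ∧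
      (∀ i, originTaylorAt hB ⟨x i, hle (x i).2⟩ = D i * (Y 0 ^ A i 0 * Y 1 ^ A i 1)) := by
  classical
  letI := inclusionAlgebra hle
  haveI iR := isLocalRing_originLocalRing ha
  haveI iS := isLocalRing_originLocalRing hB
  obtain ⟨-, -, n, -, hdimSn, instR, instS, x, y, δ, A, hx, hy, hdet, hxy⟩ := hmono
  have hn : n = 2 := by
    have h2 : ((n : ℕ) : WithBot ℕ∞) = (2 : ℕ) := hdimSn.symm.trans (ringKrullDim_originLocalRing hB)
    exact_mod_cast h2
  subst hn
  have hinstR : instR = iR := Subsingleton.elim _ _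
  have hinstS : instS = iS := Subsingleton.elim _ _
  subst hinstR
  subst hinstS
  refine ⟨x, fun j => originTaylorAt hB (y j), fun i => originTaylorAt hB (δ i : originLocalRing hB), A, hx,
    fun j => ?_, fun k => ?_, fun i => ?_, hdet, fun i => ?_⟩
  · exact (constantCoeff_originTaylorAt_eq_zero_iff hB (y j)).mpr (hy ▸ Ideal.subset_span ⟨j, rfl⟩)
  · have hk : originCoord hB k ∈ Ideal.span (Set.range y) := by
      rw [hy]; exact originCoord_mem_maximalIdeal hB k
    obtain ⟨cf, hcf⟩ := Ideal.mem_span_range_iff_exists_fun.mp hk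
    refine ⟨originTaylorAt hB (cf 0), originTaylorAt hB (cf 1), ?_⟩
    have h := congrArg (originTaylorAt hB) hcf
    rw [Fin.sum_univ_two, map_add, map_mul, map_mul, originTaylorAt_coord] at h
    exact h.symm
  · exact (constantCoeff_originTaylorAt_ne_zero_iff hB _).mpr (Units.isUnit _)
  · have h := congrArg (originTaylorAt hB) (hxy i)
    rw [Fin.prod_univ_two, map_mul, map_mul, map_pow, map_pow] at h
    exact h

/-- **Endgame for `0 ≤ i ≤ p − 2`.** If `x_i = X` divides the leading form of (the expansion in
`B̂_i` of) every element of `𝔪_A`, then `A → B_i` is not monomial: for a monomial form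
`xⱼ = δⱼ y₀^{aⱼ₀} y₁^{aⱼ₁}` the variable `X` would divide `L(y_k)` for one `k` with
`a₀ₖ, a₁ₖ ≥ 1`, so `y_k` — of order one with nonzero `X`-coefficient — would divide `u` and `v`
in `B̂_i`, which the divisor lemma excludes.
[cite: Cutkosky2014, Lemma 3.1 (proof: "Thus `x_i ∣ L(u' − φ(v))`, a contradiction")] -/
theorem endgame_X (hmono : @IsMonomialExtension (originLocalRing ha) (originLocalRing hB) _ _ (inclusionAlgebra hle))
    {p i : ℕ} (hip : i < p) {U₁ E₂ E₃ : MvPowerSeries (Fin 2) F} (hU₁ : constantCoeff U₁ ≠ 0)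
    (hE₂ : constantCoeff E₂ ≠ 0) (hE₃ : constantCoeff E₃ ≠ 0)
    (hTu : originTaylorAt hB ⟨a 0, hle (mem_originLocalRing_self ha 0)⟩ = X 0 ^ p * X 1 ^ (p * i) * U₁)
    (hTv : originTaylorAt hB ⟨a 1, hle (mem_originLocalRing_self ha 1)⟩ = X 1 ^ i * (X 0 * E₂ + X 1 ^ (p - i) * E₃))
    (HX : ∀ z : originLocalRing ha, (haveI := isLocalRing_originLocalRing ha; z ∈ maximalIdeal (originLocalRing ha)) →
      (X 0 : MvPowerSeries (Fin 2) F) ∣ leadingForm (originTaylorAt hB ⟨z, hle z.2⟩)) : False := by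
  classical
  haveI iR := isLocalRing_originLocalRing ha
  haveI iS := isLocalRing_originLocalRing hB
  haveI := isDomain_mvPowerSeries (F := F) (Fin 2)
  obtain ⟨x, Y, D, A, hx, hY0, hspan, hD, hdet, hTx⟩ := exists_series_of_isMonomialExtension hB ha hle hmono
  set T := originTaylorAt hB with hT
  obtain ⟨⟨hord0, hL0⟩, ⟨hord1, hL1⟩, hnd⟩ := linearForms_of_span (hY0 0) (hY0 1) hspan
  set ℓ : Fin 2 → MvPowerSeries (Fin 2) F := fun j => homogeneousComponent 1 (Y j) with hℓ
  have hLy : ∀ j, leadingForm (Y j) = ℓ j := by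
    intro j; fin_cases j
    · exact hL0
    · exact hL1
  have hordY : ∀ j, (Y j).order = ((1 : ℕ) : ℕ∞) := by
    intro j; fin_cases j
    · exact hord0
    · exact hord1
  have hYne : ∀ j, Y j ≠ 0 := by
    intro j hz
    have h := hordY j
    rw [hz, order_zero] at h
    exact ENat.top_ne_coe _ h
  have hLx : ∀ i', leadingForm (T ⟨x i', hle (x i').2⟩) = C (constantCoeff (D i')) * ℓ 0 ^ A i' 0 * ℓ 1 ^ A i' 1 := by
    intro i'
    rw [hTx, leadingForm_mul, leadingForm_mul, leadingForm_pow, leadingForm_pow,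
      leadingForm_of_constantCoeff_ne_zero (hD i'), hLy 0, hLy 1, mul_assoc]
  have hxm : ∀ i', x i' ∈ maximalIdeal (originLocalRing ha) := fun i' => hx ▸ Ideal.subset_span ⟨i', rfl⟩
  have hXd : ∀ i', ((X 0 : MvPowerSeries (Fin 2) F) ∣ ℓ 0 ∧ 1 ≤ A i' 0) ∨ ((X 0 : MvPowerSeries (Fin 2) F) ∣ ℓ 1 ∧ 1 ≤ A i' 1) := by
    intro i'
    have h := HX (x i') (hxm i')
    rw [hLx i'] at h
    exact X_dvd_linear_pow_mul_pow (hD i') 0 h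
  -- an index `j` with `X ∣ ℓ j` and positive exponents in both rows
  have key : ∃ j : Fin 2, (X 0 : MvPowerSeries (Fin 2) F) ∣ ℓ j ∧ 1 ≤ A 0 j ∧ 1 ≤ A 1 j := by
    rcases hXd 0 with ⟨h0, a0⟩ | ⟨h0, a0⟩ <;> rcases hXd 1 with ⟨h1, a1⟩ | ⟨h1, a1⟩
    · exact ⟨0, h0, a0, a1⟩
    · exact absurd ⟨h0, h1⟩ (hnd 0)
    · exact absurd ⟨h1, h0⟩ (hnd 0)
    · exact ⟨1, h0, a0, a1⟩
  obtain ⟨j, hXℓ, hA0, hA1⟩ := key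
  have hApos : ∀ i', 1 ≤ A i' j := by
    intro i'; fin_cases i'
    · exact hA0
    · exact hA1
  -- `Y j` divides `T x₀`, `T x₁`, hence `T u`, `T v`
  have hYdx : ∀ i', Y j ∣ T ⟨x i', hle (x i').2⟩ := by
    intro i'
    rw [hTx]
    have hj : Y j ∣ Y 0 ^ A i' 0 * Y 1 ^ A i' 1 := by
      have hne : A i' j ≠ 0 := Nat.one_le_iff_ne_zero.mp (hApos i')
      fin_cases j
      · exact dvd_mul_of_dvd_left (dvd_pow_self _ hne) _
      · exact dvd_mul_of_dvd_right (dvd_pow_self _ hne) _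
    exact dvd_mul_of_dvd_right hj _
  have hmemR : ∀ w : originLocalRing ha, w ∈ maximalIdeal (originLocalRing ha) → Y j ∣ T ⟨w, hle w.2⟩ := by
    intro w hw
    rw [← hx] at hw
    obtain ⟨cf, hcf⟩ := Ideal.mem_span_range_iff_exists_fun.mp hw
    have e : (⟨w, hle w.2⟩ : originLocalRing hB) = Subalgebra.inclusion hle w := rfl
    rw [e, ← hcf, map_sum, map_sum]
    refine Finset.dvd_sum fun i' _ => ?_
    rw [map_mul, map_mul]
    exact dvd_mul_of_dvd_right (hYdx i') _
  have hu : Y j ∣ X 0 ^ p * X 1 ^ (p * i) * U₁ := by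
    rw [← hTu]
    exact hmemR (originCoord ha 0) (originCoord_mem_maximalIdeal ha 0)
  have hv : Y j ∣ X 1 ^ i * (X 0 * E₂ + X 1 ^ (p - i) * E₃) := by
    rw [← hTv]
    exact hmemR (originCoord ha 1) (originCoord_mem_maximalIdeal ha 1)
  -- `Y j` has nonzero `X`-coefficient
  have hWX : coeff (Finsupp.single 0 1) (Y j) ≠ 0 := by
    have e : coeff (Finsupp.single 0 1) (Y j) = coeff (Finsupp.single 0 1) (ℓ j) := by
      rw [hℓ]
      simp only
      rw [coeff_homogeneousComponent, if_pos (by rw [Finsupp.degree_single])]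
    rw [e]
    intro h0
    have h1 : coeff (Finsupp.single 1 1) (ℓ j) = 0 := (X_dvd_iff.mp hXℓ) _ (by simp)
    have hℓ0 : ℓ j = 0 := eq_zero_of_isHomogeneous_one (isHomogeneous_homogeneousComponent _ 1) h0 h1
    exact leadingForm_ne_zero (hYne j) (by rw [hLy j, hℓ0])
  exact false_of_dvd_Tu_of_dvd_Tv hip hU₁ hE₂ hE₃ (hY0 j) hWX hu hv

/-- **The comparison behind the endgame for `i = p − 1`** (pure series statement, `m = p − 1`):
for `Tx = D · Pᵅ · Qᵝ` with `D` a unit, `P = Y·(unit)` (leading form `η₀ Y`), `Q` of order one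
with leading form not divisible by `Y`, if `ord Tx = (m+1)²j + (m+1)k`, the leading form of `Tx`
is divisible by `Y` exactly to the power `(m+1)²j + mk`, and `Y^{(m²+m+1)j+mk+1} ∤ Tx`, then
`j = 0` and `α = m β`. [cite: Cutkosky2014, Lemma 3.1 (proof, case `i = p − 1`)] -/
theorem endgame_Y_core (m : ℕ) (hm : 1 ≤ m) {P Q : MvPowerSeries (Fin 2) F} {η₀ : F} (hη₀ : η₀ ≠ 0)
    (hP1 : (X 1 : MvPowerSeries (Fin 2) F) ∣ P) (hLP : leadingForm P = C η₀ * X 1)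
    (hLQ : leadingForm Q = homogeneousComponent 1 Q)
    (hQ1 : ¬ (X 1 : MvPowerSeries (Fin 2) F) ∣ homogeneousComponent 1 Q) (hPne : P ≠ 0) (hQne : Q ≠ 0)
    {Tx D : MvPowerSeries (Fin 2) F} (hD : constantCoeff D ≠ 0) {α β : ℕ} (hTx : Tx = D * (P ^ α * Q ^ β))
    {j k : ℕ} (hord : Tx.order = (((m + 1) ^ 2 * j + (m + 1) * k : ℕ) : ℕ∞))
    (hL : (X 1 : MvPowerSeries (Fin 2) F) ^ ((m + 1) ^ 2 * j + m * k) ∣ leadingForm Tx)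
    (hL' : ¬ (X 1 : MvPowerSeries (Fin 2) F) ^ ((m + 1) ^ 2 * j + m * k + 1) ∣ leadingForm Tx)
    (hν : ¬ (X 1 : MvPowerSeries (Fin 2) F) ^ ((m ^ 2 + m + 1) * j + m * k + 1) ∣ Tx) :
    j = 0 ∧ α = m * β := by
  haveI := isDomain_mvPowerSeries (F := F) (Fin 2)
  have hTxne : Tx ≠ 0 := by
    rw [hTx]
    refine mul_ne_zero (fun h => hD (by rw [h, map_zero])) (mul_ne_zero (pow_ne_zero _ hPne) (pow_ne_zero _ hQne))
  -- the leading form of `Tx`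
  have hLTx : leadingForm Tx = C (constantCoeff D) * ((C η₀ * X 1) ^ α * (homogeneousComponent 1 Q) ^ β) := by
    rw [hTx, leadingForm_mul, leadingForm_mul, leadingForm_pow, leadingForm_pow, leadingForm_of_constantCoeff_ne_zero hD,
      hLP, hLQ]
  -- (1) exact `Y`-power of the leading form: `α`
  have hexact : (X 1 : MvPowerSeries (Fin 2) F) ^ (0 + (1 * α + 0 * β)) ∣ leadingForm Tx ∧
      ¬ (X 1 : MvPowerSeries (Fin 2) F) ^ (0 + (1 * α + 0 * β) + 1) ∣ leadingForm Tx := by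
    rw [hLTx]
    obtain ⟨h1, h1'⟩ := X_pow_dvd_pow_and_not_dvd 1 (X_pow_one_dvd_C_mul_X_and_not_dvd 1 hη₀).1
      (X_pow_one_dvd_C_mul_X_and_not_dvd 1 hη₀).2 α
    obtain ⟨h2, h2'⟩ := X_pow_dvd_pow_and_not_dvd 1 (X_pow_zero_dvd_and_not_dvd_of_not_dvd 1 hQ1).1
      (X_pow_zero_dvd_and_not_dvd_of_not_dvd 1 hQ1).2 β
    obtain ⟨h3, h3'⟩ := X_pow_dvd_mul_and_not_dvd 1 h1 h1' h2 h2'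
    obtain ⟨h0, h0'⟩ := X_pow_zero_dvd_and_not_dvd_of_constantCoeff_ne_zero 1 (f := C (constantCoeff D))
      (by rwa [constantCoeff_C])
    exact X_pow_dvd_mul_and_not_dvd 1 h0 h0' h3 h3'
  have eq1 : (m + 1) ^ 2 * j + m * k = α := by
    have := eq_of_X_pow_dvd_and_not_dvd 1 hL hL' hexact.1 hexact.2
    omega
  -- (2) the order of `Tx`: `α + β`
  have h01 : IsHomogeneous (C η₀ * X 1 : MvPowerSeries (Fin 2) F) (0 + 1) :=
    IsHomogeneous.mul (isHomogeneous_C η₀) (isHomogeneous_X 1)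
  rw [zero_add] at h01
  have hhom' : IsHomogeneous (C (constantCoeff D) * ((C η₀ * X 1) ^ α * (homogeneousComponent 1 Q) ^ β) :
      MvPowerSeries (Fin 2) F) (0 + (1 * α + 1 * β)) :=
    IsHomogeneous.mul (isHomogeneous_C _)
      (IsHomogeneous.mul (IsHomogeneous.pow_fin2 h01 α) (IsHomogeneous.pow_fin2 (isHomogeneous_homogeneousComponent Q 1) β))
  have hhom : IsHomogeneous (leadingForm Tx) (0 + (1 * α + 1 * β)) := by
    rw [hLTx]; exact hhom'
  have eq2 : (m + 1) ^ 2 * j + (m + 1) * k = α + β := by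
    have h1 := order_toNat_eq_of_isHomogeneous_leadingForm hTxne hhom
    rw [hord, ENat.toNat_coe] at h1
    omega
  -- (3) the `Y`-adic bound: `α ≤ (m²+m+1) j + m k`
  have hαdvd : (X 1 : MvPowerSeries (Fin 2) F) ^ α ∣ Tx := by
    rw [hTx]
    exact dvd_mul_of_dvd_right (dvd_mul_of_dvd_left (pow_dvd_pow_of_dvd hP1 α) _) _
  have ineq3 : α ≤ (m ^ 2 + m + 1) * j + m * k := by
    by_contra hlt
    exact hν ((pow_dvd_pow _ (by omega)).trans hαdvd)
  -- conclusion
  have hj : m * j = 0 := by nlinarith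
  have hj0 : j = 0 := by
    rcases Nat.mul_eq_zero.mp hj with h | h
    · omega
    · exact h
  subst hj0
  refine ⟨rfl, ?_⟩
  have e1 : α = m * k := by rw [← eq1]; ring
  have e2 : m * k + k = α + β := by rw [← eq2]; ring
  obtain rfl : β = k := by omega
  exact e1

/-- **Endgame for `i = p − 1`** (`m = p − 1 ≥ 1`). Suppose every element `z` of `𝔪_A` has
`ȳ = Y ∣ T z`, and every nonzero one admits `j, k` with `ord T z = (m+1)²j + (m+1)k`, leading form
divisible by `Y` exactly to the power `(m+1)²j + mk`, and `Y^{(m²+m+1)j+mk+1} ∤ T z`. Then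
`A → B_{p−1}` is not monomial: in a monomial form `xᵢ = δᵢ y₀^{aᵢ₀} y₁^{aᵢ₁}` one parameter
`y_j` is `ȳ·(unit)` (otherwise `ȳ ∤ T x₀`), and `endgame_Y_core` gives `aᵢⱼ = m·aᵢⱼ'` for both
rows, so `det a = 0`. [cite: Cutkosky2014, Lemma 3.1 (proof, case `i = p − 1`)] -/
theorem endgame_Y (hmono : @IsMonomialExtension (originLocalRing ha) (originLocalRing hB) _ _ (inclusionAlgebra hle))
    (m : ℕ) (hm : 1 ≤ m)
    (HY : ∀ z : originLocalRing ha, (haveI := isLocalRing_originLocalRing ha; z ∈ maximalIdeal (originLocalRing ha)) →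
      (X 1 : MvPowerSeries (Fin 2) F) ∣ originTaylorAt hB ⟨z, hle z.2⟩)
    (HK : ∀ z : originLocalRing ha, (haveI := isLocalRing_originLocalRing ha; z ∈ maximalIdeal (originLocalRing ha)) →
      z ≠ 0 → ∃ j k : ℕ,
        (originTaylorAt hB ⟨z, hle z.2⟩).order = (((m + 1) ^ 2 * j + (m + 1) * k : ℕ) : ℕ∞) ∧
        (X 1 : MvPowerSeries (Fin 2) F) ^ ((m + 1) ^ 2 * j + m * k) ∣ leadingForm (originTaylorAt hB ⟨z, hle z.2⟩) ∧
        ¬ (X 1 : MvPowerSeries (Fin 2) F) ^ ((m + 1) ^ 2 * j + m * k + 1) ∣ leadingForm (originTaylorAt hB ⟨z, hle z.2⟩) ∧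
        ¬ (X 1 : MvPowerSeries (Fin 2) F) ^ ((m ^ 2 + m + 1) * j + m * k + 1) ∣ originTaylorAt hB ⟨z, hle z.2⟩) :
    False := by
  classical
  haveI iR := isLocalRing_originLocalRing ha
  haveI iS := isLocalRing_originLocalRing hB
  haveI := isDomain_mvPowerSeries (F := F) (Fin 2)
  obtain ⟨x, Y, D, A, hx, hY0, hspan, hD, hdet, hTx⟩ := exists_series_of_isMonomialExtension hB ha hle hmono
  set T := originTaylorAt hB with hT
  obtain ⟨⟨hord0, hL0⟩, ⟨hord1, hL1⟩, hnd⟩ := linearForms_of_span (hY0 0) (hY0 1) hspan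
  set ℓ : Fin 2 → MvPowerSeries (Fin 2) F := fun j => homogeneousComponent 1 (Y j) with hℓ
  have hLy : ∀ j, leadingForm (Y j) = ℓ j := by
    intro j; fin_cases j
    · exact hL0
    · exact hL1
  have hordY : ∀ j, (Y j).order = ((1 : ℕ) : ℕ∞) := by
    intro j; fin_cases j
    · exact hord0
    · exact hord1
  have hYne : ∀ j, Y j ≠ 0 := by
    intro j hz
    have h := hordY j
    rw [hz, order_zero] at h
    exact ENat.top_ne_coe _ h
  have hxm : ∀ i', x i' ∈ maximalIdeal (originLocalRing ha) := fun i' => hx ▸ Ideal.subset_span ⟨i', rfl⟩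
  have hxne : ∀ i', x i' ≠ 0 := by
    intro i' h0
    have h := hTx i'
    have e : originTaylorAt hB ⟨x i', hle (x i').2⟩ = 0 := by
      have h' : (⟨x i', hle (x i').2⟩ : originLocalRing hB) = 0 := Subtype.ext (by rw [h0]; rfl)
      rw [h', map_zero]
    rw [e] at h
    exact mul_ne_zero (fun h' => hD i' (by rw [h', map_zero]))
      (mul_ne_zero (pow_ne_zero _ (hYne 0)) (pow_ne_zero _ (hYne 1))) h.symm
  -- one of the `Y j` is divisible by `Y`
  by_cases hex : ∃ j, (X 1 : MvPowerSeries (Fin 2) F) ∣ Y j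
  swap
  · have hex' : ∀ j, ¬ (X 1 : MvPowerSeries (Fin 2) F) ∣ Y j := fun j h => hex ⟨j, h⟩
    have h := HY (x 0) (hxm 0)
    rw [hTx 0] at h
    rcases X_dvd_or_dvd_of_dvd_mul 1 h with h | h
    · exact not_X_dvd_of_constantCoeff_ne_zero 1 (hD 0) h
    · rcases X_dvd_or_dvd_of_dvd_mul 1 h with h | h
      · exact hex' 0 (X_dvd_of_dvd_pow 1 h)
      · exact hex' 1 (X_dvd_of_dvd_pow 1 h)
  obtain ⟨j, η, hη⟩ := hex
  -- the other index
  obtain ⟨j', hjj'⟩ : ∃ j' : Fin 2, (j = 0 ∧ j' = 1) ∨ (j = 1 ∧ j' = 0) := by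
    fin_cases j
    · exact ⟨1, Or.inl ⟨rfl, rfl⟩⟩
    · exact ⟨0, Or.inr ⟨rfl, rfl⟩⟩
  -- the leading form of `Y j` is `η(0) · Y`, with `η(0) ≠ 0`; the other one is not divisible by `Y`
  have hℓj : ℓ j = C (constantCoeff η) * X 1 := by
    rw [hℓ]
    simp only
    rw [hη, homogeneousComponent_one_X_mul]
  have hη0 : constantCoeff η ≠ 0 := by
    intro h0
    apply leadingForm_ne_zero (hYne j)
    rw [hLy j, hℓj, h0, map_zero, zero_mul]
  have hXℓj : (X 1 : MvPowerSeries (Fin 2) F) ∣ ℓ j := ⟨C (constantCoeff η), by rw [hℓj, mul_comm]⟩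
  have hndj : ¬ (X 1 : MvPowerSeries (Fin 2) F) ∣ ℓ j' := by
    intro h
    rcases hjj' with ⟨rfl, rfl⟩ | ⟨rfl, rfl⟩
    · exact hnd 1 ⟨hXℓj, h⟩
    · exact hnd 1 ⟨h, hXℓj⟩
  -- apply the core comparison to both rows
  have hrow : ∀ i', A i' j = m * A i' j' := by
    intro i'
    obtain ⟨j₀, k, hord, hL, hL', hν⟩ := HK (x i') (hxm i') (hxne i')
    have hTx' : T ⟨x i', hle (x i').2⟩ = D i' * (Y j ^ A i' j * Y j' ^ A i' j') := by
      rw [hTx i']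
      rcases hjj' with ⟨rfl, rfl⟩ | ⟨rfl, rfl⟩
      · rfl
      · rw [mul_comm (Y 1 ^ A i' 1)]
    exact (endgame_Y_core m hm hη0 ⟨η, hη⟩ (by rw [hLy j, hℓj]) (hLy j') hndj (hYne j) (hYne j') (hD i')
      hTx' hord hL hL' hν).2
  -- the determinant vanishes
  apply hdet
  rw [Matrix.det_fin_two]
  simp only [Matrix.map_apply]
  have h0 := hrow 0
  have h1 := hrow 1
  rcases hjj' with ⟨rfl, rfl⟩ | ⟨rfl, rfl⟩
  · rw [h0, h1]
    push_cast
    ring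
  · rw [h0, h1]
    push_cast
    ring

end Endgame

/-! ## The two regimes: leading forms of all elements of `𝔪_A` in `B̂_i` -/

section Regimes

variable (p : ℕ) [hp : Fact p.Prime] [CharP F p] {a b : Fin 2 → L} (ha : AlgebraicIndependent F a)
  (hb : AlgebraicIndependent F b) (hAB : originLocalRing ha ≤ originLocalRing hb)

/-- **The sheared element in `B̂_i`** (Frobenius): with `T u = Xᵖ Y^{pi} U₁` and
`T v = Yⁱ (X E₂ + Yʳ E₃)`, `T u − c (T v)ᵖ = Y^{pi} (Xᵖ (U₁ − c E₂ᵖ) − c Y^{rp} E₃ᵖ)`.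
[cite: Cutkosky2014, Lemma 3.1 (proof)] -/
theorem shear_expansion {i r : ℕ} {Tu Tv U₁ E₂ E₃ : MvPowerSeries (Fin 2) F} (c : F)
    (hTu : Tu = X 0 ^ p * X 1 ^ (p * i) * U₁) (hTv : Tv = X 1 ^ i * (X 0 * E₂ + X 1 ^ r * E₃)) :
    Tu - C c * Tv ^ p = X 1 ^ (p * i) * (X 0 ^ p * (U₁ - C c * E₂ ^ p) - C c * X 1 ^ (r * p) * E₃ ^ p) := by
  haveI := charP_mvPowerSeries (R := F) (Fin 2) p
  rw [hTu, hTv, mul_pow, add_pow_char, mul_pow, mul_pow, ← pow_mul, ← pow_mul, mul_comm i p]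
  ring

/-- **Regime `0 ≤ i ≤ p − 2`: `x_i` divides the leading form of every element of `𝔪_A` in
`B̂_i`.** In the sheared presentation `(ũ, v)`, `ũ = u − (c₀/e₀ᵖ)vᵖ`, one has
`L(ũ) = x_iᵖ y_i^{pi} · (f₀ y_i + λ x_i)` (order `pi + p + 1`) and `L(v) = e₀ x_i y_iⁱ` (order
`i + 1`); for `z = h(ũ,v)/g(ũ,v) ∈ 𝔪_A` the terms of minimal weighted order of `h` have leading
forms `x_i^{pj+k} · (…)` with pairwise distinct exponents `pj + k ≥ 1`, so no cancellation occurs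
and `x_i ∣ L(T z)`. [cite: Cutkosky2014, Lemma 3.1 (proof, cases `i = 0` and `1 ≤ i < p − 1`)] -/
theorem X_dvd_leadingForm_of_mem_maximalIdeal {c₀ f₀ e₀ : F} {τ₀ : MvPowerSeries (Fin 2) F}
    (hshape : LemmaShape p hb ⟨a 0, hAB (mem_originLocalRing_self ha 0)⟩
      ⟨a 1, hAB (mem_originLocalRing_self ha 1)⟩ c₀ f₀ e₀ τ₀)
    (α : F) {i : ℕ} (hip2 : i + 2 ≤ p) (hB : AlgebraicIndependent F (bCoord F L p (b 0) (b 1) α i))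
    (hle : originLocalRing ha ≤ originLocalRing hB) (z : originLocalRing ha)
    (hz : haveI := isLocalRing_originLocalRing ha; z ∈ maximalIdeal (originLocalRing ha)) :
    (X 0 : MvPowerSeries (Fin 2) F) ∣ leadingForm (originTaylorAt hB ⟨z, hle z.2⟩) := by
  haveI := isLocalRing_originLocalRing ha
  haveI := isLocalRing_originLocalRing hB
  haveI := isDomain_mvPowerSeries (F := F) (Fin 2)
  have hp0 : p ≠ 0 := hp.out.ne_zero
  have hip : i < p := by omega
  obtain ⟨hleB, U₁, E₂, E₃, hU₁0, hU₁Y, hE₂0, hE₃0, hTu, hTv⟩ := expansions_in_Bi p ha hb hAB hshape α hip hB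
  obtain ⟨hc, hf, he, -, hτ0, -, -⟩ := hshape
  -- the zero element
  by_cases hz0 : z = 0
  · have e : (⟨(z : L), hle z.2⟩ : originLocalRing hB) = 0 := Subtype.ext (by rw [hz0]; rfl)
    rw [e, map_zero, leadingForm_zero]
    exact dvd_zero _
  set T := originTaylorAt hB with hT
  have hTu1 : T ⟨a 0, hle (mem_originLocalRing_self ha 0)⟩ = X 0 ^ p * X 1 ^ (p * i) * U₁ := hTu
  have hTv1 : T ⟨a 1, hle (mem_originLocalRing_self ha 1)⟩ = X 1 ^ i * (X 0 * E₂ + X 1 ^ (p - i) * E₃) := hTv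
  -- `u, v ∈ 𝔪_{B_i}`
  have hmax : ∀ j, (⟨a j, hle (mem_originLocalRing_self ha j)⟩ : originLocalRing hB) ∈ maximalIdeal (originLocalRing hB) := by
    refine Fin.forall_fin_two.mpr ⟨?_, ?_⟩
    · rw [← constantCoeff_originTaylorAt_eq_zero_iff, hTu1, map_mul, map_mul, map_pow, constantCoeff_X, zero_pow hp0,
        zero_mul, zero_mul]
    · rw [← constantCoeff_originTaylorAt_eq_zero_iff, hTv1]
      simp only [map_mul, map_add, map_pow, constantCoeff_X, zero_mul, zero_add]
      rw [zero_pow (show p - i ≠ 0 by omega), zero_mul, mul_zero]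
  -- the shear constant and the sheared pair
  set c : F := c₀ / e₀ ^ p with hcdef
  have hce : c₀ - c * e₀ ^ p = 0 := by rw [hcdef, div_mul_cancel₀ _ (pow_ne_zero _ he), sub_self]
  set V := U₁ - C c * E₂ ^ p with hV
  have hV0 : constantCoeff V = 0 := by
    rw [hV, map_sub, map_mul, map_pow, constantCoeff_C, hU₁0, hE₂0, hce]
  have hV1eq : homogeneousComponent 1 V = homogeneousComponent 1 U₁ := by
    rw [hV, map_sub, show C c * E₂ ^ p = c • E₂ ^ p from (smul_eq_C_mul _ c).symm, map_smul,
      homogeneousComponent_one_pow_char p E₂, smul_zero, sub_zero]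
  have hℓU : homogeneousComponent 1 U₁ = C (coeff (Finsupp.single 0 1) U₁) * X 0 + C f₀ * X 1 := by
    rw [homogeneousComponent_one_eq, hU₁Y]
  have hV1 : homogeneousComponent 1 V ≠ 0 := by
    rw [hV1eq]
    intro h0
    have h1 := congrArg (coeff (Finsupp.single 1 1)) h0
    rw [coeff_homogeneousComponent, if_pos (by rw [Finsupp.degree_single]), hU₁Y, map_zero] at h1
    exact hf h1
  set q : Fin 2 → MvPowerSeries (Fin 2) F :=
    ![T ⟨a 0, hle (mem_originLocalRing_self ha 0)⟩ - C c * T ⟨a 1, hle (mem_originLocalRing_self ha 1)⟩ ^ p,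
      T ⟨a 1, hle (mem_originLocalRing_self ha 1)⟩] with hq
  have hq0 : q 0 = X 1 ^ (p * i) * (X 0 ^ p * V - C c * X 1 ^ ((p - i) * p) * E₃ ^ p) := by
    simp only [hq, Matrix.cons_val_zero]
    rw [hV]
    exact shear_expansion p c hTu1 hTv1
  have hq1 : q 1 = X 1 ^ i * (X 0 * E₂ + X 1 ^ (p - i) * E₃) := by
    simp only [hq, Matrix.cons_val_one, Matrix.cons_val_fin_one]
    exact hTv1
  -- orders and leading forms of the pair
  have hs : p + 2 ≤ (p - i) * p := by
    have h2 : 2 ≤ p - i := by omega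
    nlinarith
  obtain ⟨hord0, hL0⟩ := order_and_leadingForm_q0_X (p * i) p ((p - i) * p) hs (G := E₃ ^ p) c hV0 hV1
  obtain ⟨hord1, hL1⟩ := order_and_leadingForm_q1_X i (p - i) (by omega) (E₃ := E₃) hE₂0 he
  rw [← hq0] at hord0 hL0
  rw [← hq1] at hord1 hL1
  have hqne : ∀ j, q j ≠ 0 := by
    refine Fin.forall_fin_two.mpr ⟨fun h0 => ?_, fun h0 => ?_⟩
    · rw [h0, order_zero] at hord0; exact ENat.top_ne_coe _ hord0
    · rw [h0, order_zero] at hord1; exact ENat.top_ne_coe _ hord1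
  have hwt0 : wt q 0 = p * i + p + 1 := by
    show (q 0).order.toNat = _
    rw [hord0, ENat.toNat_coe]
  have hwt1 : wt q 1 = i + 1 := by
    show (q 1).order.toNat = _
    rw [hord1, ENat.toNat_coe]
  -- the element
  obtain ⟨h, G, hG0, hh0, hhc, hmul⟩ := exists_rep_of_mem_maximalIdeal ha hB hle hmax c hp0 z hz hz0
  have hmul' : T ⟨z, hle z.2⟩ * G = MvPolynomial.aeval q h := hmul
  -- the minimal weight
  have hsupp : h.support.Nonempty :=
    Finset.nonempty_iff_ne_empty.mpr fun hε => hh0 (MvPolynomial.support_eq_empty.mp hε)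
  obtain ⟨em, hem, hmin⟩ := Finset.exists_min_image h.support (fun e => Finsupp.weight (wt q) e) hsupp
  set d₀ := Finsupp.weight (wt q) em with hd₀
  have hd : ∀ e ∈ h.support, d₀ ≤ Finsupp.weight (wt q) e := hmin
  -- the line form as a sum of extremal terms
  set S := h.support.filter (fun e => Finsupp.weight (wt q) e = d₀) with hS
  set g : (Fin 2 →₀ ℕ) → MvPowerSeries (Fin 2) F := fun e =>
    C (MvPolynomial.coeff e h) * C e₀ ^ (e 1) * X 1 ^ (p * i * e 0 + i * e 1) * (homogeneousComponent 1 V) ^ e 0 with hg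
  set N : (Fin 2 →₀ ℕ) → ℕ := fun e => p * e 0 + e 1 with hN
  have hlf : lineForm q h d₀ = ∑ e ∈ S, X 0 ^ N e * g e := by
    rw [lineForm]
    refine Finset.sum_congr rfl fun e _ => ?_
    rw [hL0, hL1, hg, hN]
    simp only
    ring
  have hgX : ∀ e ∈ S, ¬ (X 0 : MvPowerSeries (Fin 2) F) ∣ g e := by
    intro e hes
    apply not_X_dvd_of_killVar_ne_zero
    have hkV : killVar 0 (homogeneousComponent 1 V) = PowerSeries.C f₀ * PowerSeries.X := by
      rw [hV1eq, hℓU, map_add, map_mul, map_mul, killVar_C, killVar_C, killVar_X_self, mul_zero, zero_add,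
        killVar_zero_X_one]
    rw [hg]
    simp only
    rw [map_mul, map_mul, map_mul, map_pow, map_pow, map_pow, killVar_C, killVar_C, killVar_zero_X_one, hkV]
    have hhe : MvPolynomial.coeff e h ≠ 0 := MvPolynomial.mem_support_iff.mp (Finset.mem_filter.mp hes).1
    have hC : ∀ x : F, x ≠ 0 → (PowerSeries.C x : PowerSeries F) ≠ 0 := fun x hx => (map_ne_zero PowerSeries.C).mpr hx
    exact mul_ne_zero (mul_ne_zero (mul_ne_zero (hC _ hhe) (pow_ne_zero _ (hC _ he))) (pow_ne_zero _ PowerSeries.X_ne_zero))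
      (pow_ne_zero _ (mul_ne_zero (hC _ hf) PowerSeries.X_ne_zero))
  have hNinj : Set.InjOn N S := by
    intro e he e' he' hee'
    have hw := (Finset.mem_filter.mp (Finset.mem_coe.mp he)).2
    have hw' := (Finset.mem_filter.mp (Finset.mem_coe.mp he')).2
    rw [weight_wt_eq, hwt0, hwt1] at hw hw'
    refine finsupp_eq_of_weights_eq (n₀ := p * i + p + 1) (n₁ := i + 1) (e₀ := p) (e₁ := 1) ?_ ?_ ?_
    · intro h1
      have : p * i + p + 1 = i * p + p := by linarith
      nlinarith [mul_comm p i]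
    · linarith
    · have : p * e 0 + e 1 = p * e' 0 + e' 1 := hee'
      linarith
  obtain ⟨i₀, hi₀, hi₀min⟩ := Finset.exists_min_image S N ⟨em, Finset.mem_filter.mpr ⟨hem, rfl⟩⟩
  obtain ⟨hdvd, hndvd⟩ := X_pow_dvd_sum_and_not_dvd S N g 0 hgX hNinj hi₀ hi₀min
  rw [← hlf] at hdvd hndvd
  have hlf_ne : lineForm q h d₀ ≠ 0 := fun h0 => hndvd (by rw [h0]; exact dvd_zero _)
  obtain ⟨-, hLead⟩ := order_aeval_eq_and_leadingForm_eq q hqne h hd hlf_ne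
  -- `N i₀ ≥ 1`
  have hN1 : N i₀ ≠ 0 := by
    have hi₀s : i₀ ∈ h.support := (Finset.mem_filter.mp hi₀).1
    have hne0 : i₀ ≠ 0 := by
      rintro rfl
      exact (MvPolynomial.mem_support_iff.mp hi₀s) hhc
    intro hN0
    apply hne0
    have h0 : p * i₀ 0 + i₀ 1 = 0 := hN0
    have h00 : i₀ 0 = 0 := by
      rcases Nat.eq_zero_of_add_eq_zero h0 with ⟨h1, -⟩
      rcases Nat.mul_eq_zero.mp h1 with h2 | h2
      · exact (hp0 h2).elim
      · exact h2
    exact finsupp_fin2_ext (by simpa using h00) (by simp; omega)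
  have hXlf : (X 0 : MvPowerSeries (Fin 2) F) ∣ lineForm q h d₀ := (dvd_pow_self (X 0) hN1).trans hdvd
  -- transfer to `T z`
  have hLz : leadingForm (T ⟨z, hle z.2⟩) * C (constantCoeff G) = lineForm q h d₀ := by
    rw [← hLead, ← hmul', leadingForm_mul, leadingForm_of_constantCoeff_ne_zero hG0]
  have hLz' : leadingForm (T ⟨z, hle z.2⟩) = lineForm q h d₀ * C (constantCoeff G)⁻¹ := by
    rw [← hLz, mul_assoc, ← map_mul, mul_inv_cancel₀ hG0, map_one, mul_one]
  rw [hLz']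
  exact dvd_mul_of_dvd_left hXlf _

omit [CharP F p] in
/-- **Regime `i ≥ 1`: `ȳ = y_i` divides every element of `𝔪_A` in `B̂_i`** (both `T u` and
`T v` are divisible by `y_i`). [cite: Cutkosky2014, Lemma 3.1 (proof)] -/
theorem X_one_dvd_of_mem_maximalIdeal {c₀ f₀ e₀ : F} {τ₀ : MvPowerSeries (Fin 2) F}
    (hshape : LemmaShape p hb ⟨a 0, hAB (mem_originLocalRing_self ha 0)⟩
      ⟨a 1, hAB (mem_originLocalRing_self ha 1)⟩ c₀ f₀ e₀ τ₀)
    (α : F) {i : ℕ} (hi : i < p) (hi1 : 1 ≤ i) (hB : AlgebraicIndependent F (bCoord F L p (b 0) (b 1) α i))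
    (hle : originLocalRing ha ≤ originLocalRing hB) (z : originLocalRing ha)
    (hz : haveI := isLocalRing_originLocalRing ha; z ∈ maximalIdeal (originLocalRing ha)) :
    (X 1 : MvPowerSeries (Fin 2) F) ∣ originTaylorAt hB ⟨z, hle z.2⟩ := by
  haveI := isLocalRing_originLocalRing ha
  have hp0 : p ≠ 0 := hp.out.ne_zero
  obtain ⟨hleB, U₁, E₂, E₃, -, -, -, -, hTu, hTv⟩ := expansions_in_Bi p ha hb hAB hshape α hi hB
  have hTu1 : originTaylorAt hB ⟨a 0, hle (mem_originLocalRing_self ha 0)⟩ = X 0 ^ p * X 1 ^ (p * i) * U₁ := hTu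
  have hTv1 : originTaylorAt hB ⟨a 1, hle (mem_originLocalRing_self ha 1)⟩ =
      X 1 ^ i * (X 0 * E₂ + X 1 ^ (p - i) * E₃) := hTv
  rw [maximalIdeal_originLocalRing ha] at hz
  obtain ⟨cf, hcf⟩ := Ideal.mem_span_range_iff_exists_fun.mp hz
  have e : (⟨(z : L), hle z.2⟩ : originLocalRing hB) = Subalgebra.inclusion hle z := rfl
  rw [e, ← hcf, map_sum, map_sum]
  have hcoord : ∀ j : Fin 2, (X 1 : MvPowerSeries (Fin 2) F) ∣ originTaylorAt hB (Subalgebra.inclusion hle (originCoord ha j)) := by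
    refine Fin.forall_fin_two.mpr ⟨?_, ?_⟩
    · change (X 1 : MvPowerSeries (Fin 2) F) ∣ originTaylorAt hB ⟨a 0, hle (mem_originLocalRing_self ha 0)⟩
      rw [hTu1]
      exact dvd_mul_of_dvd_left (dvd_mul_of_dvd_right (dvd_pow_self _ (Nat.mul_ne_zero hp0 (by omega))) _) _
    · change (X 1 : MvPowerSeries (Fin 2) F) ∣ originTaylorAt hB ⟨a 1, hle (mem_originLocalRing_self ha 1)⟩
      rw [hTv1]
      exact dvd_mul_of_dvd_left (dvd_pow_self _ (by omega)) _
  refine Finset.dvd_sum fun j _ => ?_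
  rw [map_mul, map_mul]
  exact dvd_mul_of_dvd_right (hcoord j) _

/-- **Regime `i = p − 1`: order, `ȳ`-adic order of the leading form, and a `ȳ`-adic bound, for
every nonzero element of `𝔪_A` in `B̂_{p−1}`.** In the sheared presentation,
`L(ũ) = −(c₀/e₀ᵖ)τ̄₀ᵖ ȳ^{p²}` (order `p²`), `L(v) = ȳ^{p−1}(e₀x̄ + τ̄₀ȳ)` (order `p`), while
`ȳ^{p²−p+1} ∥ ũ` with `(ũ/ȳ^{p²−p+1})(x̄,0) = x̄ᵖ·(f₀ + …)` (this is where `f₀ ≠ 0` enters) and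
`ȳ^{p−1} ∥ v`. For `z = h(ũ,v)/g(ũ,v) ∈ 𝔪_A ∖ 0` with extremal exponent `(j,k)` on the line of
minimal weighted order: `ord T z = p²j + pk`, `ȳ^{p²j+(p−1)k} ∥ L(T z)`, and
`ȳ^{(p²−p+1)j+(p−1)k+1} ∤ T z`. (Stated with `i = p − 1`.)
[cite: Cutkosky2014, Lemma 3.1 (proof, case `i = p − 1`)] -/
theorem orders_of_mem_maximalIdeal_last {c₀ f₀ e₀ : F} {τ₀ : MvPowerSeries (Fin 2) F}
    (hshape : LemmaShape p hb ⟨a 0, hAB (mem_originLocalRing_self ha 0)⟩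
      ⟨a 1, hAB (mem_originLocalRing_self ha 1)⟩ c₀ f₀ e₀ τ₀)
    (α : F) {i : ℕ} (hpi : p = i + 1) (hi1 : 1 ≤ i) (hB : AlgebraicIndependent F (bCoord F L p (b 0) (b 1) α i))
    (hle : originLocalRing ha ≤ originLocalRing hB) (z : originLocalRing ha)
    (hz : haveI := isLocalRing_originLocalRing ha; z ∈ maximalIdeal (originLocalRing ha)) (hz0 : z ≠ 0) :
    ∃ j k : ℕ,
      (originTaylorAt hB ⟨z, hle z.2⟩).order = (((i + 1) ^ 2 * j + (i + 1) * k : ℕ) : ℕ∞) ∧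
      (X 1 : MvPowerSeries (Fin 2) F) ^ ((i + 1) ^ 2 * j + i * k) ∣ leadingForm (originTaylorAt hB ⟨z, hle z.2⟩) ∧
      ¬ (X 1 : MvPowerSeries (Fin 2) F) ^ ((i + 1) ^ 2 * j + i * k + 1) ∣ leadingForm (originTaylorAt hB ⟨z, hle z.2⟩) ∧
      ¬ (X 1 : MvPowerSeries (Fin 2) F) ^ ((i ^ 2 + i + 1) * j + i * k + 1) ∣ originTaylorAt hB ⟨z, hle z.2⟩ := by
  subst hpi
  haveI := isLocalRing_originLocalRing ha
  haveI := isLocalRing_originLocalRing hB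
  haveI := isDomain_mvPowerSeries (F := F) (Fin 2)
  haveI := charP_powerSeries (R := F) (i + 1)
  have hi : i < i + 1 := by omega
  obtain ⟨hleB, U₁, E₂, E₃, hU₁0, hU₁Y, hE₂0, hE₃0, hkU₁, hkE₂, hTu, hTv⟩ :=
    expansions_in_Bi_fine ha (i + 1) hb hAB hshape α hi hi1 hB
  obtain ⟨hc, hf, he, -, hτ0, -, -⟩ := hshape
  rw [Nat.add_sub_cancel_left] at hTv
  set T := originTaylorAt hB with hT
  have hTu1 : T ⟨a 0, hle (mem_originLocalRing_self ha 0)⟩ = X 0 ^ (i + 1) * X 1 ^ ((i + 1) * i) * U₁ := hTu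
  have hTv1 : T ⟨a 1, hle (mem_originLocalRing_self ha 1)⟩ = X 1 ^ i * (X 0 * E₂ + X 1 ^ 1 * E₃) := hTv
  -- `u, v ∈ 𝔪_{B_i}`
  have hmax : ∀ j, (⟨a j, hle (mem_originLocalRing_self ha j)⟩ : originLocalRing hB) ∈ maximalIdeal (originLocalRing hB) := by
    refine Fin.forall_fin_two.mpr ⟨?_, ?_⟩
    · rw [← constantCoeff_originTaylorAt_eq_zero_iff, hTu1, map_mul, map_mul, map_pow, constantCoeff_X,
        zero_pow (by omega), zero_mul, zero_mul]
    · rw [← constantCoeff_originTaylorAt_eq_zero_iff, hTv1]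
      simp only [map_mul, map_add, map_pow, constantCoeff_X, zero_mul, zero_add, pow_one, mul_zero]
  -- the shear constant, the sheared pair, the fine structure `V = ȳ · D`, `D(0) = f₀`
  set τb : F := constantCoeff τ₀ with hτb
  set c : F := c₀ / e₀ ^ (i + 1) with hcdef
  have hc0 : c ≠ 0 := div_ne_zero hc (pow_ne_zero _ he)
  have hce : c₀ - c * e₀ ^ (i + 1) = 0 := by rw [hcdef, div_mul_cancel₀ _ (pow_ne_zero _ he), sub_self]
  have hcτ : c * τb ^ (i + 1) ≠ 0 := mul_ne_zero hc0 (pow_ne_zero _ hτ0)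
  set V := U₁ - C c * E₂ ^ (i + 1) with hV
  have hV0 : constantCoeff V = 0 := by
    rw [hV, map_sub, map_mul, map_pow, constantCoeff_C, hU₁0, hE₂0, hce]
  have hkV : killVar 1 V = 0 := by
    rw [hV, map_sub, map_mul, map_pow, killVar_C, hkU₁, hkE₂, ← map_pow, ← map_mul, ← map_sub, hce, map_zero]
  obtain ⟨D, hVD⟩ := (killVar_eq_zero_iff 1 V).mp hkV
  have hD0 : constantCoeff D = f₀ := by
    have h1 : coeff (Finsupp.single 1 1) V = f₀ := by
      rw [hV, map_sub, coeff_C_mul, coeff_single_one_pow_eq_zero (i + 1) 1 E₂, mul_zero, sub_zero, hU₁Y]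
    rwa [hVD, coeff_single_one_X_mul] at h1
  set q : Fin 2 → MvPowerSeries (Fin 2) F :=
    ![T ⟨a 0, hle (mem_originLocalRing_self ha 0)⟩ - C c * T ⟨a 1, hle (mem_originLocalRing_self ha 1)⟩ ^ (i + 1),
      T ⟨a 1, hle (mem_originLocalRing_self ha 1)⟩] with hq
  have hq0 : q 0 = X 1 ^ ((i + 1) * i) * (X 0 ^ (i + 1) * V - C c * X 1 ^ (i + 1) * E₃ ^ (i + 1)) := by
    simp only [hq, Matrix.cons_val_zero]
    rw [hV]
    have h := shear_expansion (i + 1) c hTu1 hTv1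
    rwa [one_mul] at h
  have hq1 : q 1 = X 1 ^ i * (X 0 * E₂ + X 1 ^ 1 * E₃) := by
    simp only [hq, Matrix.cons_val_one, Matrix.cons_val_fin_one]
    exact hTv1
  -- orders and leading forms of the pair
  obtain ⟨hord0, hL0⟩ := order_and_leadingForm_q0_Y ((i + 1) * i) (i + 1) (V := V) (G := E₃) hV0 hE₃0.symm.symm hcτ
  obtain ⟨hord1, hL1⟩ := order_and_leadingForm_q1_Y i hE₂0 (hE₃0.trans hτb.symm) he
  rw [← hq0] at hord0 hL0
  rw [← hq1] at hord1 hL1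
  have hqne : ∀ j, q j ≠ 0 := by
    refine Fin.forall_fin_two.mpr ⟨fun h0 => ?_, fun h0 => ?_⟩
    · rw [h0, order_zero] at hord0; exact ENat.top_ne_coe _ hord0
    · rw [h0, order_zero] at hord1; exact ENat.top_ne_coe _ hord1
  have hwt0 : wt q 0 = (i + 1) * i + (i + 1) := by
    show (q 0).order.toNat = _
    rw [hord0, ENat.toNat_coe]
  have hwt1 : wt q 1 = i + 1 := by
    show (q 1).order.toNat = _
    rw [hord1, ENat.toNat_coe]
  -- the element
  obtain ⟨h, G, hG0, hh0, hhc, hmul⟩ := exists_rep_of_mem_maximalIdeal ha hB hle hmax c (n := i + 1) (by omega) z hz hz0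
  have hmul' : T ⟨z, hle z.2⟩ * G = MvPolynomial.aeval q h := hmul
  -- the minimal weight and the line
  have hsupp : h.support.Nonempty :=
    Finset.nonempty_iff_ne_empty.mpr fun hε => hh0 (MvPolynomial.support_eq_empty.mp hε)
  obtain ⟨em, hem, hmin⟩ := Finset.exists_min_image h.support (fun e => Finsupp.weight (wt q) e) hsupp
  set d₀ := Finsupp.weight (wt q) em with hd₀
  have hd : ∀ e ∈ h.support, d₀ ≤ Finsupp.weight (wt q) e := hmin
  set S := h.support.filter (fun e => Finsupp.weight (wt q) e = d₀) with hS
  set g : (Fin 2 →₀ ℕ) → MvPowerSeries (Fin 2) F := fun e =>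
    C (MvPolynomial.coeff e h) * C (-(c * τb ^ (i + 1))) ^ (e 0) * (C e₀ * X 0 + C τb * X 1) ^ (e 1) with hg
  set N : (Fin 2 →₀ ℕ) → ℕ := fun e => ((i + 1) * i + (i + 1)) * e 0 + i * e 1 with hN
  have hlf : lineForm q h d₀ = ∑ e ∈ S, X 1 ^ N e * g e := by
    rw [lineForm]
    refine Finset.sum_congr rfl fun e _ => ?_
    rw [hL0, hL1, hg, hN]
    simp only
    rw [mul_pow, mul_pow, ← pow_mul, ← pow_mul]
    ring
  have hgY : ∀ e ∈ S, ¬ (X 1 : MvPowerSeries (Fin 2) F) ∣ g e := by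
    intro e hes
    apply not_X_dvd_of_killVar_ne_zero
    rw [hg]
    simp only
    rw [map_mul, map_mul, map_pow, map_pow, killVar_C, killVar_C, map_add, map_mul, map_mul, killVar_C, killVar_C,
      killVar_one_X_zero, killVar_X_self, mul_zero, add_zero]
    have hhe : MvPolynomial.coeff e h ≠ 0 := MvPolynomial.mem_support_iff.mp (Finset.mem_filter.mp hes).1
    have hC : ∀ x : F, x ≠ 0 → (PowerSeries.C x : PowerSeries F) ≠ 0 := fun x hx => (map_ne_zero PowerSeries.C).mpr hx
    exact mul_ne_zero (mul_ne_zero (hC _ hhe) (pow_ne_zero _ (hC _ (neg_ne_zero.mpr hcτ))))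
      (pow_ne_zero _ (mul_ne_zero (hC _ he) PowerSeries.X_ne_zero))
  have hNinj : Set.InjOn N S := by
    intro e hes e' hes' hee'
    have hw := (Finset.mem_filter.mp (Finset.mem_coe.mp hes)).2
    have hw' := (Finset.mem_filter.mp (Finset.mem_coe.mp hes')).2
    rw [weight_wt_eq, hwt0, hwt1] at hw hw'
    refine finsupp_eq_of_weights_eq (n₀ := (i + 1) * i + (i + 1)) (n₁ := i + 1) (e₀ := (i + 1) * i + (i + 1)) (e₁ := i)
      ?_ ?_ ?_
    · intro h1
      nlinarith
    · linarith
    · exact hee'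
  obtain ⟨i₀, hi₀, hi₀min⟩ := Finset.exists_min_image S N ⟨em, Finset.mem_filter.mpr ⟨hem, rfl⟩⟩
  have hi₀s : i₀ ∈ h.support := (Finset.mem_filter.mp hi₀).1
  have hwi₀ : Finsupp.weight (wt q) i₀ = d₀ := (Finset.mem_filter.mp hi₀).2
  obtain ⟨hdvd, hndvd⟩ := X_pow_dvd_sum_and_not_dvd S N g 1 hgY hNinj hi₀ hi₀min
  rw [← hlf] at hdvd hndvd
  have hlf_ne : lineForm q h d₀ ≠ 0 := fun h0 => hndvd (by rw [h0]; exact dvd_zero _)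
  obtain ⟨horder, hLead⟩ := order_aeval_eq_and_leadingForm_eq q hqne h hd hlf_ne
  -- the `ȳ`-adic bound (no cancellation on `ȳ = 0`)
  have hq0' : q 0 = X 1 ^ ((i + 1) * i + 1) * (X 0 ^ (i + 1) * D - C c * X 1 ^ i * E₃ ^ (i + 1)) := by
    rw [hq0, hVD]
    ring
  have hr₀ : killVar 1 (X 0 ^ (i + 1) * D - C c * X 1 ^ i * E₃ ^ (i + 1)) = PowerSeries.X ^ (i + 1) * killVar 1 D := by
    rw [map_sub, map_mul, map_mul, map_mul, map_pow, map_pow, map_pow, killVar_one_X_zero, killVar_X_self, killVar_C,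
      zero_pow (by omega), mul_zero, zero_mul, sub_zero]
  have hq1' : q 1 = X 1 ^ i * (X 0 * E₂ + X 1 * E₃) := by rw [hq1, pow_one]
  have hr₁ : killVar 1 (X 0 * E₂ + X 1 * E₃) = PowerSeries.X ^ 1 * killVar 1 E₂ := by
    rw [map_add, map_mul, map_mul, killVar_one_X_zero, killVar_X_self, zero_mul, add_zero, pow_one]
  have hρ₀ : PowerSeries.constantCoeff (killVar 1 D) ≠ 0 := by
    rw [constantCoeff_killVar, hD0]; exact hf
  have hρ₁ : PowerSeries.constantCoeff (killVar 1 E₂) ≠ 0 := by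
    rw [constantCoeff_killVar, hE₂0]; exact he
  have hdet' : ((i + 1) * i + 1) * 1 ≠ i * (i + 1) := by
    intro h1
    nlinarith
  have hν := not_X_one_pow_dvd_aeval hdet' hρ₀ hρ₁ hr₀ hr₁ q hq0' hq1' h hi₀s
  -- transfer to `T z`
  have hGo : G.order = 0 := by
    by_contra hne
    exact hG0 (order_ne_zero_iff_constCoeff_eq_zero.mp hne)
  have hordz : (T ⟨z, hle z.2⟩).order = d₀ := by
    rw [← hmul', order_mul, hGo, add_zero] at horder
    exact horder
  have hLz : leadingForm (T ⟨z, hle z.2⟩) * C (constantCoeff G) = lineForm q h d₀ := by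
    rw [← hLead, ← hmul', leadingForm_mul, leadingForm_of_constantCoeff_ne_zero hG0]
  have hLz' : leadingForm (T ⟨z, hle z.2⟩) = lineForm q h d₀ * C (constantCoeff G)⁻¹ := by
    rw [← hLz, mul_assoc, ← map_mul, mul_inv_cancel₀ hG0, map_one, mul_one]
  have hunit := X_pow_zero_dvd_and_not_dvd_of_constantCoeff_ne_zero 1 (f := C (constantCoeff G)⁻¹)
    (by rw [constantCoeff_C]; exact inv_ne_zero hG0)
  obtain ⟨h1, h2⟩ := X_pow_dvd_mul_and_not_dvd 1 hdvd hndvd hunit.1 hunit.2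
  have hNe : N i₀ + 0 = (i + 1) ^ 2 * i₀ 0 + i * i₀ 1 := by
    rw [hN]; simp only; ring
  rw [hNe, ← hLz'] at h1 h2
  have hd₀' : d₀ = (i + 1) ^ 2 * i₀ 0 + (i + 1) * i₀ 1 := by
    rw [← hwi₀, weight_wt_eq, hwt0, hwt1]
    ring
  refine ⟨i₀ 0, i₀ 1, ?_, h1, h2, ?_⟩
  · rw [hordz, hd₀']
  · intro hcon
    apply hν
    have hexp : (i ^ 2 + i + 1) * i₀ 0 + i * i₀ 1 + 1 = ((i + 1) * i + 1) * i₀ 0 + i * i₀ 1 + 1 := by ring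
    rw [← hexp, ← hmul']
    exact dvd_mul_of_dvd_left hcon G

/-- **(C4) of Lemma 3.1**: `A → B_i` is not monomial for `0 ≤ i < p`.
[cite: Cutkosky2014, Lemma 3.1 ("Further, `A → B_i` is not monomial for `0 ≤ i < p`")] -/
theorem lemma31_C4 {c₀ f₀ e₀ : F} {τ₀ : MvPowerSeries (Fin 2) F}
    (hshape : LemmaShape p hb ⟨a 0, hAB (mem_originLocalRing_self ha 0)⟩
      ⟨a 1, hAB (mem_originLocalRing_self ha 1)⟩ c₀ f₀ e₀ τ₀)
    (α : F) {i : ℕ} (hi : i < p) (hB : AlgebraicIndependent F (bCoord F L p (b 0) (b 1) α i))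
    (hle : originLocalRing ha ≤ originLocalRing hB) :
    ¬ @IsMonomialExtension (originLocalRing ha) (originLocalRing hB) _ _ (inclusionAlgebra hle) := by
  intro hmono
  obtain ⟨hleB, U₁, E₂, E₃, hU₁0, -, hE₂0, hE₃0, hTu, hTv⟩ := expansions_in_Bi p ha hb hAB hshape α hi hB
  have hc : c₀ ≠ 0 := hshape.1
  have he : e₀ ≠ 0 := hshape.2.2.1
  have hτ0 : constantCoeff τ₀ ≠ 0 := hshape.2.2.2.2.1
  have hU₁ : constantCoeff U₁ ≠ 0 := by rw [hU₁0]; exact hc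
  have hE₂ : constantCoeff E₂ ≠ 0 := by rw [hE₂0]; exact he
  have hE₃ : constantCoeff E₃ ≠ 0 := by rw [hE₃0]; exact hτ0
  rcases Nat.lt_or_ge (i + 1) p with hlt | hge
  · exact endgame_X hB ha hle hmono hi hU₁ hE₂ hE₃ hTu hTv
      (fun z hz => X_dvd_leadingForm_of_mem_maximalIdeal p ha hb hAB hshape α (by omega) hB hle z hz)
  · have hpi : p = i + 1 := by omega
    have hi1 : 1 ≤ i := by have := hp.out.two_le; omega
    exact endgame_Y hB ha hle hmono i hi1
      (fun z hz => X_one_dvd_of_mem_maximalIdeal p ha hb hAB hshape α hi hi1 hB hle z hz)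
      (fun z hz hz0 => orders_of_mem_maximalIdeal_last p ha hb hAB hshape α hpi hi1 hB hle z hz hz0)

end Regimes

/-! ## Discharge of the named fact `CutkoskyLemma31` -/

/-- **Discharge of `CutkoskyLemma31`** (Cutkosky, Math. Ann. 362 (2015), Lemma 3.1, for the
algebraic local rings `A = F[u,v]_{(u,v)} ⊆ B = F[x,y]_{(x,y)}`): (C1) no quadratic transform of
`A` is dominated by `B_i`, `0 ≤ i < p` (`lemma31_C1`, file `…LemmaShape.lean`); (C2)–(C3) `B_p`
dominates `A_p` and the expansions (5) hold in `B̂_p` (`lemma31_C23`, file `…LemmaBlock.lean`);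
(C4) `A → B_i` is not monomial for `0 ≤ i < p` (`lemma31_C4`, this file).
[cite: Cutkosky2014, Lemma 3.1] -/
theorem CutkoskyLemma31_holds : CutkoskyLemma31.{u} := by
  intro F _ p _ _ _ L _ _ a b ha hb hAB _ c₀ f₀ e₀ τ₀ hshape α hα0 hα
  refine ⟨fun i hi hB A' hqt hdomA' => ?_, fun hB hA => ?_, fun i hi hB hle => ?_⟩
  · exact lemma31_C1 p ha hb hAB hshape α hi hB A' hqt hdomA'.1
  · exact lemma31_C23 p ha hb hAB hshape hα0 hα hB hA
  · exact lemma31_C4 p ha hb hAB hshape α hi hB hle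

end Cutkosky

end Literature.Barriers.ResolutionOfSingularities
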